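import Summits.RiemannHypothesis.RiemannHypothesis.Theorems.WeilFormatCEntryGram
import Summits.RiemannHypothesis.RiemannHypothesis.Theorems.WeilFormatCDigammaEdgeBounds
import Summits.RiemannHypothesis.RiemannHypothesis.Theorems.WeilFormatCTrigammaEdgeBound
import HarnessLib

/-!
# Format C: the ARCHIMEDEAN block of Yoshida's Gram matrix in the two sectors — closed forms and entry bounds

Route context: Fourier–Galerkin / Schur-complement certificates of Weil positivity on a window ("format C";
cell memo `run/shared/lean/pub/rh-explicit/rh-explicit-weil-10/FORMATC-DESIGN.md` §4.2–4.3 DIAG/DIG/EXP, §9.1; supporting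
stmt-RiemannHypothesis-0098; seat rh-explicit-weil-10).  Third analytic piece of L-C3a on the actual kernel: the sector
kernels of `Yoshida1992.archCoeff a` (the `r₁ = 1` part of (5.15)/(5.16)) on modes `n, m ≥ 1`,
`A⁺(n,m) = (A(n,m) + A(n,−m))/2` and `A⁻(n,m) = (A(n,m) − A(n,−m))/2` (weil-2's SectorSplit kernels off mode 0).
Notation: `ω_n = πn/a`, `Y_n = Im ψ(¼ + iω_n/2)`, `T_n = archExpSumSin a n = Σ_k e^{−2a l_k} ω_n/(l_k² + ω_n²)`,
`S_n = archExpSumDiag a n`, `E = Σ_k e^{−2a l_k} = weilArchDensity (2a)`.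

* CLOSED FORMS (`n ≠ m`): `A⁺(n,m) = (−1)^{n+m}[(nY_n − mY_m)/(2π(n²−m²)) − (nT_n − mT_m)/(π(n²−m²))]`
  (`evenArch_offDiag_eq`), `A⁻(n,m) = (−1)^{n+m}[(mY_n − nY_m)/(2π(n²−m²)) − (mT_n − nT_m)/(π(n²−m²))]`
  (`oddArch_offDiag_eq`); diagonal `A^±(n,n) = ½[Re ψ(¼+iω_n/2) − log π + Re ψ′(¼+iω_n/2)/(4a) − S_n/a] ± (Y_n − 2T_n)/(4πn)`
  (`evenArch_diag_eq`, `oddArch_diag_eq`) — FORMATC-DESIGN §4.2 in M-units (= W-units/2);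
* ENTRY BOUNDS (`0 < a`, `1 ≤ n`): `|Y_n − π/2| ≤ 2a/(πn)` (D1, `abs_im_digamma_freq_sub_le`), `0 ≤ T_n ≤ Ea/(πn)`
  (`archExpSumSin_nonneg`, `archExpSumSin_le`), `|S_n| ≤ Ea²/(π²n²)` (`abs_archExpSumDiag_le`),
  `|Re ψ′(¼+iω_n/2)|/(4a) ≤ 1/(4n) + a/(π²n²)` (D2, `abs_re_deriv_digamma_freq_div_le`).

The consequences (Hilbert main part `±(−1)^{n+m}/(4(n+m))` + remainder `|R| ≤ a(1+E)/(π²·min(n,m)·|n−m|)`, diagonal lower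
bounds, far assembly) are the sequel `WeilFormatCArchFarBound.lean`.  Elementary; standard axioms; no definitions; no RH claim.
-/

set_option autoImplicit false
-- `Summit.RiemannHypothesis.RiemannHypothesis.…` is the layout-mandated namespace (summit = problem name).
set_option linter.dupNamespace false

noncomputable section

open Complex Finset
open scoped Real BigOperators

namespace Summit.RiemannHypothesis.RiemannHypothesis.Theorems.WeilFormatC

open Literature.NumberTheory.LFunctions Literature.NumberTheory.LFunctions.Yoshida1992
open Literature.Analysis.SpecialFunctions

variable {a : ℝ}

/-! ## Signs and frequencies -/

/-- `(−1)^{n + (−m)} = (−1)^{n+m}` in `ℝ`. -/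
theorem neg_one_zpow_add_neg (n m : ℤ) : (-1 : ℝ) ^ (n + -m) = (-1) ^ (n + m) := by
  rw [zpow_add₀ (by norm_num : (-1 : ℝ) ≠ 0), zpow_add₀ (by norm_num : (-1 : ℝ) ≠ 0)]
  congr 1
  rcases Int.even_or_odd m with h | h
  · rw [h.neg_one_zpow, h.neg.neg_one_zpow]
  · rw [h.neg_one_zpow, h.neg.neg_one_zpow]

/-- `(−1)^{n + (−n)} = 1`. -/
theorem neg_one_zpow_add_neg_self (n : ℤ) : (-1 : ℝ) ^ (n + -n) = 1 := by
  rw [add_neg_cancel, zpow_zero]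

/-- `ω_n = πn/a` for a natural index. -/
theorem freq_natCast (a : ℝ) (n : ℕ) : freq a (n : ℤ) = π * n / a := by
  unfold freq; push_cast; ring

/-- `ω_n > 0` for `n ≥ 1`, `a > 0`. -/
theorem freq_pos (ha : 0 < a) {n : ℕ} (hn : 1 ≤ n) : 0 < freq a (n : ℤ) := by
  rw [freq_natCast]
  have : (0 : ℝ) < n := by exact_mod_cast hn
  positivity

/-! ## Closed forms of the sector kernels of `archCoeff` -/

section ClosedForms

/-- **Even sector, off-diagonal** (`n ≠ m`, `n, m ≥ 1`):
`(A(n,m) + A(n,−m))/2 = (−1)^{n+m}[(nY_n − mY_m)/(2π(n²−m²)) − (nT_n − mT_m)/(π(n²−m²))]`. -/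
theorem evenArch_offDiag_eq (a : ℝ) {n m : ℕ} (hn : 1 ≤ n) (hm : 1 ≤ m) (hnm : n ≠ m) :
    (archCoeff a n m + archCoeff a n (-(m : ℤ))) / 2
      = (-1 : ℝ) ^ ((n : ℤ) + m) *
          (((n : ℝ) * (Complex.digamma (1 / 4 + ((freq a n : ℝ) : ℂ) / 2 * I)).im
              - m * (Complex.digamma (1 / 4 + ((freq a m : ℝ) : ℂ) / 2 * I)).im) / (2 * π * ((n : ℝ) ^ 2 - m ^ 2))
            - ((n : ℝ) * archExpSumSin a n - m * archExpSumSin a m) / (π * ((n : ℝ) ^ 2 - m ^ 2))) := by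
  have h1 : (n : ℤ) ≠ m := by exact_mod_cast hnm
  have h2 : (n : ℤ) ≠ -(m : ℤ) := by omega
  have hd1 : (n : ℝ) - m ≠ 0 := sub_ne_zero.mpr (by exact_mod_cast hnm)
  have hd2 : (n : ℝ) + m ≠ 0 := by positivity
  have hd3 : (n : ℝ) ^ 2 - m ^ 2 ≠ 0 := by
    rw [sq_sub_sq]; exact mul_ne_zero hd2 hd1
  -- the two entries in closed form
  have hA1 : archCoeff a n m = -(-1 : ℝ) ^ ((n : ℤ) + m) / (π * ((n : ℝ) - m)) *
      (((Complex.digamma (1 / 4 + ((freq a m : ℝ) : ℂ) / 2 * I)).im / 2 - archExpSumSin a m) -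
        ((Complex.digamma (1 / 4 + ((freq a n : ℝ) : ℂ) / 2 * I)).im / 2 - archExpSumSin a n)) := by
    unfold archCoeff
    rw [if_neg h1]
    push_cast
    ring
  have hA2 : archCoeff a n (-(m : ℤ)) = -(-1 : ℝ) ^ ((n : ℤ) + m) / (π * ((n : ℝ) + m)) *
      ((-(Complex.digamma (1 / 4 + ((freq a m : ℝ) : ℂ) / 2 * I)).im / 2 + archExpSumSin a m) -
        ((Complex.digamma (1 / 4 + ((freq a n : ℝ) : ℂ) / 2 * I)).im / 2 - archExpSumSin a n)) := by
    unfold archCoeff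
    rw [if_neg h2, freq_neg, im_digamma_quarter_neg, archExpSumSin_neg, neg_one_zpow_add_neg]
    push_cast
    ring
  rw [hA1, hA2]
  field_simp
  ring

/-- **Odd sector, off-diagonal** (`n ≠ m`, `n, m ≥ 1`):
`(A(n,m) − A(n,−m))/2 = (−1)^{n+m}[(mY_n − nY_m)/(2π(n²−m²)) − (mT_n − nT_m)/(π(n²−m²))]`. -/
theorem oddArch_offDiag_eq (a : ℝ) {n m : ℕ} (hn : 1 ≤ n) (hm : 1 ≤ m) (hnm : n ≠ m) :
    (archCoeff a n m - archCoeff a n (-(m : ℤ))) / 2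
      = (-1 : ℝ) ^ ((n : ℤ) + m) *
          (((m : ℝ) * (Complex.digamma (1 / 4 + ((freq a n : ℝ) : ℂ) / 2 * I)).im
              - n * (Complex.digamma (1 / 4 + ((freq a m : ℝ) : ℂ) / 2 * I)).im) / (2 * π * ((n : ℝ) ^ 2 - m ^ 2))
            - ((m : ℝ) * archExpSumSin a n - n * archExpSumSin a m) / (π * ((n : ℝ) ^ 2 - m ^ 2))) := by
  have h1 : (n : ℤ) ≠ m := by exact_mod_cast hnm
  have h2 : (n : ℤ) ≠ -(m : ℤ) := by omega
  have hd1 : (n : ℝ) - m ≠ 0 := sub_ne_zero.mpr (by exact_mod_cast hnm)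
  have hd2 : (n : ℝ) + m ≠ 0 := by positivity
  have hd3 : (n : ℝ) ^ 2 - m ^ 2 ≠ 0 := by
    rw [sq_sub_sq]; exact mul_ne_zero hd2 hd1
  -- the two entries in closed form
  have hA1 : archCoeff a n m = -(-1 : ℝ) ^ ((n : ℤ) + m) / (π * ((n : ℝ) - m)) *
      (((Complex.digamma (1 / 4 + ((freq a m : ℝ) : ℂ) / 2 * I)).im / 2 - archExpSumSin a m) -
        ((Complex.digamma (1 / 4 + ((freq a n : ℝ) : ℂ) / 2 * I)).im / 2 - archExpSumSin a n)) := by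
    unfold archCoeff
    rw [if_neg h1]
    push_cast
    ring
  have hA2 : archCoeff a n (-(m : ℤ)) = -(-1 : ℝ) ^ ((n : ℤ) + m) / (π * ((n : ℝ) + m)) *
      ((-(Complex.digamma (1 / 4 + ((freq a m : ℝ) : ℂ) / 2 * I)).im / 2 + archExpSumSin a m) -
        ((Complex.digamma (1 / 4 + ((freq a n : ℝ) : ℂ) / 2 * I)).im / 2 - archExpSumSin a n)) := by
    unfold archCoeff
    rw [if_neg h2, freq_neg, im_digamma_quarter_neg, archExpSumSin_neg, neg_one_zpow_add_neg]
    push_cast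
    ring
  rw [hA1, hA2]
  field_simp
  ring

/-- **Even sector, diagonal** (`n ≥ 1`):
`(A(n,n) + A(n,−n))/2 = ½[Re ψ(¼+iω_n/2) − log π + Re ψ′(¼+iω_n/2)/(4a) − S_n/a] + (Y_n − 2T_n)/(4πn)`. -/
theorem evenArch_diag_eq (a : ℝ) {n : ℕ} (hn : 1 ≤ n) :
    (archCoeff a n n + archCoeff a n (-(n : ℤ))) / 2
      = (reDigammaQuarter (freq a n) - Real.log π
          + (deriv Complex.digamma (1 / 4 + ((freq a n : ℝ) : ℂ) / 2 * I)).re / (4 * a)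
          - archExpSumDiag a n / a) / 2
        + ((Complex.digamma (1 / 4 + ((freq a n : ℝ) : ℂ) / 2 * I)).im - 2 * archExpSumSin a n) / (4 * π * n) := by
  have h2 : (n : ℤ) ≠ -(n : ℤ) := by omega
  unfold archCoeff
  rw [if_pos rfl, if_neg h2, freq_neg, im_digamma_quarter_neg, archExpSumSin_neg, neg_one_zpow_add_neg_self]
  have hd : (n : ℝ) ≠ 0 := by exact_mod_cast (show n ≠ 0 by omega)
  push_cast
  field_simp
  ring

/-- **Odd sector, diagonal** (`n ≥ 1`):
`(A(n,n) − A(n,−n))/2 = ½[Re ψ(¼+iω_n/2) − log π + Re ψ′(¼+iω_n/2)/(4a) − S_n/a] − (Y_n − 2T_n)/(4πn)`. -/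
theorem oddArch_diag_eq (a : ℝ) {n : ℕ} (hn : 1 ≤ n) :
    (archCoeff a n n - archCoeff a n (-(n : ℤ))) / 2
      = (reDigammaQuarter (freq a n) - Real.log π
          + (deriv Complex.digamma (1 / 4 + ((freq a n : ℝ) : ℂ) / 2 * I)).re / (4 * a)
          - archExpSumDiag a n / a) / 2
        - ((Complex.digamma (1 / 4 + ((freq a n : ℝ) : ℂ) / 2 * I)).im - 2 * archExpSumSin a n) / (4 * π * n) := by
  have h2 : (n : ℤ) ≠ -(n : ℤ) := by omega
  unfold archCoeff
  rw [if_pos rfl, if_neg h2, freq_neg, im_digamma_quarter_neg, archExpSumSin_neg, neg_one_zpow_add_neg_self]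
  have hd : (n : ℝ) ≠ 0 := by exact_mod_cast (show n ≠ 0 by omega)
  push_cast
  field_simp
  ring

end ClosedForms

/-! ## Entry bounds -/

section Bounds

/-- **(D1) on the frequencies**: `|Y_n − π/2| ≤ 2a/(πn)` for `n ≥ 1`, `a > 0` (`Y_n = Im ψ(¼ + iω_n/2)`, `ω_n = πn/a`). -/
theorem abs_im_digamma_freq_sub_le (ha : 0 < a) {n : ℕ} (hn : 1 ≤ n) :
    |(Complex.digamma (1 / 4 + ((freq a n : ℝ) : ℂ) / 2 * I)).im - π / 2| ≤ 2 * a / (π * n) := by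
  have hω := freq_pos ha hn
  set w : ℂ := 1 / 4 + ((freq a n : ℝ) : ℂ) / 2 * I with hw
  have hre : w.re = 1 / 4 := by simp [hw]
  have him : w.im = freq a n / 2 := by simp [hw]
  have h := abs_im_digamma_sub_pi_div_two_le (w := w) (by rw [hre]; norm_num) (by rw [hre]; norm_num)
    (by rw [him]; positivity)
  rw [him] at h
  refine h.trans (le_of_eq ?_)
  rw [freq_natCast]
  have hn' : (0 : ℝ) < n := by exact_mod_cast hn
  field_simp

/-- `E = Σ_k e^{−2a l_k}` is `weilArchDensity (2a)` (`a > 0`). -/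
theorem hasSum_exp_neg_two_mul_digammaNode (ha : 0 < a) :
    HasSum (fun k : ℕ ↦ Real.exp (-(2 * a * digammaNode k))) (weilArchDensity (2 * a)) := by
  have h := hasSum_exp_neg_digammaNode_mul (t := 2 * a) (by positivity)
  refine h.congr_fun fun k ↦ ?_
  ring_nf

/-- `0 ≤ T_n` for `n ≥ 1` (`T_n = Σ_k e^{−2a l_k} ω_n/(l_k² + ω_n²)`, `ω_n > 0`). -/
theorem archExpSumSin_nonneg (ha : 0 < a) {n : ℕ} (hn : 1 ≤ n) : 0 ≤ archExpSumSin a n := by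
  have hω := freq_pos ha hn
  unfold archExpSumSin
  exact tsum_nonneg fun k ↦ by
    have := digammaNode_pos k
    positivity

/-- **`T_n ≤ E·a/(πn)`** for `n ≥ 1`, `a > 0` (termwise `ω/(l² + ω²) ≤ 1/ω`, and `1/ω_n = a/(πn)`). -/
theorem archExpSumSin_le (ha : 0 < a) {n : ℕ} (hn : 1 ≤ n) :
    archExpSumSin a n ≤ weilArchDensity (2 * a) * a / (π * n) := by
  have hω := freq_pos ha hn
  have hE := hasSum_exp_neg_two_mul_digammaNode ha
  have hterm : ∀ k : ℕ, Real.exp (-(2 * a * digammaNode k)) * (freq a n / (digammaNode k ^ 2 + freq a n ^ 2))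
      ≤ Real.exp (-(2 * a * digammaNode k)) * (1 / freq a n) := by
    intro k
    refine mul_le_mul_of_nonneg_left ?_ (Real.exp_pos _).le
    rw [div_le_div_iff₀ (by have := digammaNode_pos k; positivity) hω]
    nlinarith [sq_nonneg (digammaNode k), hω]
  have hsum := (summable_s0 ha (freq a n)).tsum_le_tsum hterm (hE.summable.mul_right _)
  unfold archExpSumSin
  refine hsum.trans (le_of_eq ?_)
  rw [tsum_mul_right, hE.tsum_eq, freq_natCast]
  have hn' : (0 : ℝ) < n := by exact_mod_cast hn
  field_simp

/-- **`|S_n| ≤ E·a²/(π²n²)`** for `n ≥ 1`, `a > 0` (termwise `|(l² − ω²)/(l² + ω²)²| ≤ 1/(l² + ω²) ≤ 1/ω²`). -/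
theorem abs_archExpSumDiag_le (ha : 0 < a) {n : ℕ} (hn : 1 ≤ n) :
    |archExpSumDiag a n| ≤ weilArchDensity (2 * a) * a ^ 2 / (π ^ 2 * n ^ 2) := by
  have hω := freq_pos ha hn
  have hE := hasSum_exp_neg_two_mul_digammaNode ha
  have hterm : ∀ k : ℕ, ‖Real.exp (-(2 * a * digammaNode k)) *
      ((digammaNode k ^ 2 - freq a n ^ 2) / (digammaNode k ^ 2 + freq a n ^ 2) ^ 2)‖
        ≤ Real.exp (-(2 * a * digammaNode k)) * (1 / freq a n ^ 2) := by
    intro k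
    have hl := digammaNode_pos k
    have hD : 0 < digammaNode k ^ 2 + freq a n ^ 2 := by positivity
    rw [Real.norm_eq_abs, abs_mul, abs_of_pos (Real.exp_pos _)]
    refine mul_le_mul_of_nonneg_left ?_ (Real.exp_pos _).le
    rw [abs_div, abs_of_pos (by positivity : 0 < (digammaNode k ^ 2 + freq a n ^ 2) ^ 2),
      div_le_div_iff₀ (by positivity) (by positivity)]
    have h1 : |digammaNode k ^ 2 - freq a n ^ 2| ≤ digammaNode k ^ 2 + freq a n ^ 2 := by
      rw [abs_le]; constructor <;> nlinarith [sq_nonneg (freq a n), sq_nonneg (digammaNode k)]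
    calc |digammaNode k ^ 2 - freq a n ^ 2| * freq a n ^ 2
        ≤ (digammaNode k ^ 2 + freq a n ^ 2) * freq a n ^ 2 :=
          mul_le_mul_of_nonneg_right h1 (sq_nonneg _)
      _ ≤ 1 * (digammaNode k ^ 2 + freq a n ^ 2) ^ 2 := by
          rw [one_mul, sq (digammaNode k ^ 2 + freq a n ^ 2)]
          exact mul_le_mul_of_nonneg_left (by nlinarith [sq_nonneg (digammaNode k)]) hD.le
  have hsum := tsum_of_norm_bounded (hE.mul_right (1 / freq a n ^ 2)) hterm
  unfold archExpSumDiag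
  refine hsum.trans (le_of_eq ?_)
  rw [freq_natCast]
  have hn' : (0 : ℝ) < n := by exact_mod_cast hn
  field_simp

/-- **(D2) on the frequencies**: `|Re ψ′(¼ + iω_n/2)|/(4a) ≤ 1/(4n) + a/(π²n²)` for `n ≥ 1`, `a > 0`
(`‖ψ′(w)‖ ≤ 1/‖w‖² + π/(2|Im w|)` with `‖w‖ ≥ Im w = ω_n/2`). -/
theorem abs_re_deriv_digamma_freq_div_le (ha : 0 < a) {n : ℕ} (hn : 1 ≤ n) :
    |(deriv Complex.digamma (1 / 4 + ((freq a n : ℝ) : ℂ) / 2 * I)).re| / (4 * a)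
      ≤ 1 / (4 * n) + a / (π ^ 2 * n ^ 2) := by
  have hω := freq_pos ha hn
  set w : ℂ := 1 / 4 + ((freq a n : ℝ) : ℂ) / 2 * I with hw
  have hre : w.re = 1 / 4 := by simp [hw]
  have him : w.im = freq a n / 2 := by simp [hw]
  have h := norm_deriv_digamma_le (w := w) (by rw [hre]; norm_num) (by rw [him]; positivity)
  have h1 : |(deriv Complex.digamma w).re| ≤ ‖deriv Complex.digamma w‖ := Complex.abs_re_le_norm _
  have hnorm : w.im ^ 2 ≤ ‖w‖ ^ 2 := by
    rw [Complex.sq_norm, Complex.normSq_apply]; nlinarith [sq_nonneg w.re]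
  have him0 : 0 < w.im := by rw [him]; positivity
  have h2 : 1 / ‖w‖ ^ 2 ≤ 1 / w.im ^ 2 := one_div_le_one_div_of_le (by positivity) hnorm
  have h3 : ‖deriv Complex.digamma w‖ ≤ 1 / w.im ^ 2 + π / (2 * |w.im|) := by linarith
  rw [abs_of_pos him0, him] at h3
  have h4 : |(deriv Complex.digamma w).re| ≤ 4 / freq a n ^ 2 + π / freq a n := by
    refine (h1.trans h3).trans (le_of_eq ?_)
    field_simp
    ring
  rw [div_le_iff₀ (by positivity)]
  refine h4.trans (le_of_eq ?_)
  rw [freq_natCast]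
  have hn' : (0 : ℝ) < n := by exact_mod_cast hn
  field_simp
  ring

end Bounds

end Summit.RiemannHypothesis.RiemannHypothesis.Theorems.WeilFormatC

end
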